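import Summits.QuantumFields.YangMills.Theorems.IR.TensionRatioPlaquetteFloorOrder
import Summits.QuantumFields.YangMills.Theorems.IR.SCFloorTorusPeeling
import HarnessLib

/-!
# Crux `IR` (stmt-QuantumFields-19354), line `tension-ratio`, input `PlaquetteFloorSC` — part 3:
# one-bond peeling of strong-coupling monomials on the torus

Pooled prover `ym-ir-line-pool-p3` (gen 3).  Helper module for item `stmt-QuantumFields-19354` (`--supports`; it closes
nothing).  On the torus `(ℤ/L)⁴`, `L ≥ 2`, with product Haar measure on the link configuration `U : Edge 4 L → G`:

* §1 geometry of the plaquette `p₀ = (0; 0, 1)` (whose `1 × 1` Wilson loop is the line's `torusRect … S 1 1`): a plaquette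
  containing both bonds `(0, 0)` and `(0, 1)` of `p₀` IS `p₀` (`eq_of_mem_pedges_of_mem_pedges`), and the plaquettes sharing a
  bond with `p₀` are based at one of `≤ 15` sites, so there are at most `15 · #planes` of them, uniformly in `L`
  (`card_touching_le`);
* §2 reading a plaquette through ONE of its bonds: for every matrix representation `φ`,
  `tr φ(U_q[ℓ := g]) = tr(φ(g^{±1}) K)` with `K` independent of `g` (`exists_trace_holonomy_update`; the four cases of
  `SCFloor.plaquetteHolonomy_update` and cyclicity of the trace);
* §3 **the peeling lemma** `integral_obs_prod_eq_zero`: the product of the `π`-plaquette observable `Re tr π(U_q)`, of factors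
  `ψₐ` of which fewer than `k` read the bond `ℓ` of `q` (each through an affine `ρ`-form `a + Re tr(ρ(g^{±1})M)`, the others
  not at all) and of an `ℓ`-blind weight `R` integrates to ZERO — disintegrate along `ℓ` (`SCFloor.integral_pi_eq_integral_
  integral_update`) and apply the single-link vanishing below the order `k` of part 2.  This is what kills every monomial of
  the strong-coupling expansion of `⟨Re tr π(U_{p₀})⟩` of degree `< k`, and every degree-`k` monomial other than `cost(p₀)^k`,
  UNIFORMLY in the volume (part 4).

Everything is proved; no new definitions; nothing here bears on the Yang–Mills mass gap.
-/

set_option autoImplicit false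

noncomputable section

open MeasureTheory Finset Function
open Literature.MathematicalPhysics.QuantumFieldTheory
open Summit.QuantumFields.YangMills.Cruxes.IR.SCFloor (mem_pedges plaquetteHolonomy_update plaquetteHolonomy_update_of_not_mem
  integral_pi_eq_integral_integral_update shift_ne_self)

namespace Summit.QuantumFields.YangMills.Cruxes.IR.TensionRatio.PlaquetteFloor

variable {L : ℕ} {G : Type*} [Group G]

/-! ## §1 Geometry of the plaquette `p₀ = (0; 0, 1)` -/

section Geometry

variable [Fact (1 < L)]

/-- On the torus of side `L ≥ 2` the unit vectors `e₀ ≠ e₁` (as translations of sites). -/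
theorem shift_zero_ne_shift_one (y : Site 4 L) : y.shift 0 ≠ y.shift 1 := by
  intro h
  have h1 := congrFun h 0
  simp only [Site.shift, Pi.add_apply, Pi.single_eq_same, Pi.single_apply, Fin.zero_eq_one_iff,
    OfNat.ofNat_ne_one, ↓reduceIte, add_zero, add_eq_left] at h1
  exact one_ne_zero h1

/-- **A plaquette containing the bonds `(0,0)` and `(0,1)` of `p₀ = (0; 0, 1)` is `p₀`.** -/
theorem eq_of_mem_pedges_of_mem_pedges {y : Site 4 L} {i j : Fin 4} (hij : i < j)
    (h0 : ((0 : Site 4 L), (0 : Fin 4)) ∈ ({(y, i), (y.shift i, j), (y.shift j, i), (y, j)} : Finset (Edge 4 L)))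
    (h1 : ((0 : Site 4 L), (1 : Fin 4)) ∈ ({(y, i), (y.shift i, j), (y.shift j, i), (y, j)} : Finset (Edge 4 L))) :
    y = 0 ∧ i = 0 ∧ j = 1 := by
  rw [mem_pedges] at h0 h1
  simp only [Prod.mk.injEq] at h0 h1
  have hj0 : j ≠ 0 := fun h => by rw [h] at hij; exact (Nat.not_lt_zero _ hij)
  -- from `h0`: `i = 0` and (`y = 0` or `y + e_j = 0`)
  have hi : i = 0 := by
    rcases h0 with ⟨-, h⟩ | ⟨-, h⟩ | ⟨-, h⟩ | ⟨-, h⟩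
    · exact h.symm
    · exact absurd h.symm hj0
    · exact h.symm
    · exact absurd h.symm hj0
  subst hi
  have hj : j = 1 := by
    rcases h1 with ⟨-, h⟩ | ⟨-, h⟩ | ⟨-, h⟩ | ⟨-, h⟩
    · exact absurd h.symm zero_ne_one
    · exact h.symm
    · exact absurd h.symm zero_ne_one
    · exact h.symm
  subst hj
  refine ⟨?_, rfl, rfl⟩
  have hy0 : y = 0 ∨ y.shift 1 = 0 := by
    rcases h0 with ⟨h, -⟩ | ⟨-, h⟩ | ⟨h, -⟩ | ⟨-, h⟩
    · exact Or.inl h.symm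
    · exact absurd h zero_ne_one
    · exact Or.inr h.symm
    · exact absurd h zero_ne_one
  have hy1 : y = 0 ∨ y.shift 0 = 0 := by
    rcases h1 with ⟨-, h⟩ | ⟨h, -⟩ | ⟨-, h⟩ | ⟨h, -⟩
    · exact absurd h.symm zero_ne_one
    · exact Or.inr h.symm
    · exact absurd h.symm zero_ne_one
    · exact Or.inl h.symm
  rcases hy0 with h | h
  · exact h
  rcases hy1 with h' | h'
  · exact h'
  exact absurd (h'.trans h.symm) (shift_zero_ne_shift_one y)

omit [Fact (1 < L)] in
/-- The sites at which a plaquette sharing a bond with `p₀ = (0; 0, 1)` can be based: if the bond `(x, m)` is one of the four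
bonds of `(y; i, j)` then `y ∈ {x, x − eᵢ, x − eⱼ}`. -/
theorem fst_mem_of_mem_pedges {x y : Site 4 L} {m i j : Fin 4}
    (h : (x, m) ∈ ({(y, i), (y.shift i, j), (y.shift j, i), (y, j)} : Finset (Edge 4 L))) :
    y ∈ ({x, x - Pi.single i 1, x - Pi.single j 1} : Finset (Site 4 L)) := by
  rw [mem_pedges] at h
  simp only [Prod.mk.injEq] at h
  simp only [Finset.mem_insert, Finset.mem_singleton]
  rcases h with ⟨h, -⟩ | ⟨h, -⟩ | ⟨h, -⟩ | ⟨h, -⟩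
  · exact Or.inl h.symm
  · right; left; rw [h]; simp [Site.shift]
  · right; right; rw [h]; simp [Site.shift]
  · exact Or.inl h.symm

omit [Fact (1 < L)] in
/-- **Uniformly few plaquettes touch `p₀`.**  The plaquettes sharing a bond with `p₀ = (0; 0, 1)` number at most
`15 · #planes` (a crude volume-independent bound: based at one of `≤ 15` sites). -/
theorem card_touching_le [NeZero L] :
    (Finset.univ.filter fun q : Plaquette 4 L =>
        ∃ e ∈ ({((0 : Site 4 L), (0 : Fin 4)), ((0 : Site 4 L).shift 0, (1 : Fin 4)), ((0 : Site 4 L).shift 1, (0 : Fin 4)),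
            ((0 : Site 4 L), (1 : Fin 4))} : Finset (Edge 4 L)),
          e ∈ ({(q.1, q.2.1.1), (q.1.shift q.2.1.1, q.2.1.2), (q.1.shift q.2.1.2, q.2.1.1), (q.1, q.2.1.2)} :
            Finset (Edge 4 L))).card ≤
      15 * Fintype.card {p : Fin 4 × Fin 4 // p.1 < p.2} := by
  classical
  set B₀ : Finset (Edge 4 L) := {((0 : Site 4 L), (0 : Fin 4)), ((0 : Site 4 L).shift 0, (1 : Fin 4)),
    ((0 : Site 4 L).shift 1, (0 : Fin 4)), ((0 : Site 4 L), (1 : Fin 4))} with hB₀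
  -- candidate base sites: first components of `B₀` minus `0` or a unit vector
  set V : Finset (Site 4 L) := insert 0 (Finset.univ.image fun n : Fin 4 => (Pi.single n 1 : Site 4 L)) with hV
  set Y : Finset (Site 4 L) := ((B₀.image Prod.fst) ×ˢ V).image fun xv => xv.1 - xv.2 with hY
  have hsub : (Finset.univ.filter fun q : Plaquette 4 L => ∃ e ∈ B₀,
      e ∈ ({(q.1, q.2.1.1), (q.1.shift q.2.1.1, q.2.1.2), (q.1.shift q.2.1.2, q.2.1.1), (q.1, q.2.1.2)} :
        Finset (Edge 4 L))) ⊆ Y ×ˢ Finset.univ := by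
    intro q hq
    rw [Finset.mem_filter] at hq
    obtain ⟨e, heB, heq⟩ := hq.2
    rw [Finset.mem_product]
    refine ⟨?_, Finset.mem_univ _⟩
    obtain ⟨x, m⟩ := e
    have hx : x ∈ B₀.image Prod.fst := Finset.mem_image.2 ⟨(x, m), heB, rfl⟩
    have hy := fst_mem_of_mem_pedges heq
    simp only [Finset.mem_insert, Finset.mem_singleton] at hy
    rw [hY, Finset.mem_image]
    rcases hy with h | h | h
    · exact ⟨(x, 0), Finset.mem_product.2 ⟨hx, by simp [hV]⟩, by simp [h]⟩
    · exact ⟨(x, Pi.single q.2.1.1 1), Finset.mem_product.2 ⟨hx, by simp [hV]⟩, by simp [h]⟩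
    · exact ⟨(x, Pi.single q.2.1.2 1), Finset.mem_product.2 ⟨hx, by simp [hV]⟩, by simp [h]⟩
  refine (Finset.card_le_card hsub).trans ?_
  rw [Finset.card_product, Finset.card_univ]
  refine Nat.mul_le_mul_right _ ?_
  calc Y.card ≤ ((B₀.image Prod.fst) ×ˢ V).card := Finset.card_image_le
    _ = (B₀.image Prod.fst).card * V.card := Finset.card_product _ _
    _ ≤ 3 * 5 := by
        refine Nat.mul_le_mul ?_ ?_
        · calc (B₀.image Prod.fst).card ≤ ({(0 : Site 4 L), (0 : Site 4 L).shift 0, (0 : Site 4 L).shift 1} :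
              Finset (Site 4 L)).card := by
                refine Finset.card_le_card fun x hx => ?_
                rw [Finset.mem_image] at hx
                obtain ⟨e, he, rfl⟩ := hx
                simp only [hB₀, Finset.mem_insert, Finset.mem_singleton] at he
                rcases he with rfl | rfl | rfl | rfl <;> simp
            _ ≤ 3 := Finset.card_le_three
        · calc V.card ≤ (Finset.univ.image fun n : Fin 4 => (Pi.single n 1 : Site 4 L)).card + 1 :=
              Finset.card_insert_le _ _
            _ ≤ Fintype.card (Fin 4) + 1 := by
                refine Nat.add_le_add_right ?_ 1
                exact Finset.card_image_le.trans (by rw [Finset.card_univ])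
            _ = 5 := by rw [Fintype.card_fin]

end Geometry

/-! ## §2 Reading a plaquette through one of its bonds -/

section Shape

variable [Fact (1 < L)] {n : ℕ} (φ : G →* Matrix (Fin n) (Fin n) ℂ)

/-- **One bond, one factor.**  Updating one bond `ℓ` of the plaquette `(x; i, j)` to `g`, the trace of the holonomy in any
matrix representation reads `tr(φ(g) K)` or `tr(φ(g⁻¹) K)` with `K` independent of `g`. -/
theorem exists_trace_holonomy_update (x : Site 4 L) {i j : Fin 4} (hij : i ≠ j) (U : GaugeConfig 4 L G)
    {ℓ : Edge 4 L} (hℓ : ℓ ∈ ({(x, i), (x.shift i, j), (x.shift j, i), (x, j)} : Finset (Edge 4 L))) :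
    ∃ (K : Matrix (Fin n) (Fin n) ℂ) (o : Bool), ∀ g : G,
      (φ (plaquetteHolonomy (update U ℓ g) x i j)).trace = (φ (if o then g else g⁻¹) * K).trace := by
  rw [mem_pedges] at hℓ
  rcases hℓ with rfl | rfl | rfl | rfl
  · refine ⟨φ (U (x.shift i, j)) * φ ((U (x.shift j, i))⁻¹) * φ ((U (x, j))⁻¹), true, fun g => ?_⟩
    rw [(plaquetteHolonomy_update x hij U g).1]
    simp only [map_mul, ↓reduceIte, mul_assoc]
  · refine ⟨φ ((U (x.shift j, i))⁻¹) * φ ((U (x, j))⁻¹) * φ (U (x, i)), true, fun g => ?_⟩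
    rw [(plaquetteHolonomy_update x hij U g).2.1]
    simp only [map_mul, ↓reduceIte]
    rw [mul_assoc (φ (U (x, i))), mul_assoc (φ (U (x, i))), Matrix.trace_mul_comm (φ (U (x, i)))]
    simp only [mul_assoc]
  · refine ⟨φ ((U (x, j))⁻¹) * φ (U (x, i)) * φ (U (x.shift i, j)), false, fun g => ?_⟩
    rw [(plaquetteHolonomy_update x hij U g).2.2.1]
    simp only [map_mul, Bool.false_eq_true, ↓reduceIte]
    rw [mul_assoc (φ (U (x, i)) * φ (U (x.shift i, j))), Matrix.trace_mul_comm (φ (U (x, i)) * φ (U (x.shift i, j)))]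
    simp only [mul_assoc]
  · refine ⟨φ (U (x, i)) * φ (U (x.shift i, j)) * φ ((U (x.shift j, i))⁻¹), false, fun g => ?_⟩
    rw [(plaquetteHolonomy_update x hij U g).2.2.2]
    simp only [map_mul, Bool.false_eq_true, ↓reduceIte]
    rw [Matrix.trace_mul_comm]

/-- The real-affine form of a plaquette cost read through one bond: `cost = N + Re tr(ρ(g^{±1}) (−K))`. -/
theorem exists_plaquetteCost_update {N : ℕ} (ρ : G →* Matrix (Fin N) (Fin N) ℂ) (q : Plaquette 4 L)
    (U : GaugeConfig 4 L G) {ℓ : Edge 4 L}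
    (hℓ : ℓ ∈ ({(q.1, q.2.1.1), (q.1.shift q.2.1.1, q.2.1.2), (q.1.shift q.2.1.2, q.2.1.1), (q.1, q.2.1.2)} :
      Finset (Edge 4 L))) :
    ∃ (a : ℝ) (M : Matrix (Fin N) (Fin N) ℂ) (o : Bool), ∀ g : G,
      plaquetteCost ρ (update U ℓ g) q = a + (ρ (if o then g else g⁻¹) * M).trace.re := by
  obtain ⟨K, o, hK⟩ := exists_trace_holonomy_update ρ q.1 (ne_of_lt q.2.2) U hℓ
  refine ⟨N, -K, o, fun g => ?_⟩
  unfold plaquetteCost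
  rw [hK g, Matrix.mul_neg, Matrix.trace_neg, Complex.neg_re, sub_eq_add_neg]

omit [Fact (1 < L)] in
/-- A plaquette cost does not read bonds outside its four bonds. -/
theorem plaquetteCost_update_of_not_mem {N : ℕ} (ρ : G →* Matrix (Fin N) (Fin N) ℂ) (q : Plaquette 4 L)
    (U : GaugeConfig 4 L G) {ℓ : Edge 4 L}
    (hℓ : ℓ ∉ ({(q.1, q.2.1.1), (q.1.shift q.2.1.1, q.2.1.2), (q.1.shift q.2.1.2, q.2.1.1), (q.1, q.2.1.2)} :
      Finset (Edge 4 L))) (g : G) :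
    plaquetteCost ρ (update U ℓ g) q = plaquetteCost ρ U q := by
  unfold plaquetteCost
  rw [plaquetteHolonomy_update_of_not_mem hℓ]

end Shape

/-! ## §3 The peeling lemma -/

section Peel

variable [Fact (1 < L)] [TopologicalSpace G] [IsTopologicalGroup G] [CompactSpace G] [MeasurableSpace G] [BorelSpace G]
  [SecondCountableTopology G] {m N : ℕ} (π : G →* Matrix (Fin m) (Fin m) ℂ) (ρ : G →* Matrix (Fin N) (Fin N) ℂ)

/-- **Peeling one bond.**  Let `ℓ` be a bond of the plaquette `(x; i, j)`, let fewer than `k` of the factors `ψₐ` (those with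
`a ∈ T`) read `ℓ`, each through an affine `ρ`-form, the others and the weight `R` being `ℓ`-blind, and let every single-link
integral with fewer than `k` `ρ`-factors vanish.  Then `∫ Re tr π(U_{x;ij}) · ∏ₐ ψₐ · R dU = 0`. -/
theorem integral_obs_prod_eq_zero (hπ : Continuous π) (hρ : Continuous ρ)
    (hρu : ∀ g, ρ g ∈ Matrix.unitaryGroup (Fin N) ℂ) {k : ℕ}
    (hV : ∀ n < k, ∀ (K : Matrix (Fin m) (Fin m) ℂ) (M : Fin n → Matrix (Fin N) (Fin N) ℂ),
      ∫ g, (π g * K).trace.re * ∏ i, (ρ g * M i).trace.re ∂haarProbability G = 0)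
    (x : Site 4 L) {i j : Fin 4} (hij : i ≠ j) {ℓ : Edge 4 L}
    (hℓ : ℓ ∈ ({(x, i), (x.shift i, j), (x.shift j, i), (x, j)} : Finset (Edge 4 L)))
    {n : ℕ} (ψ : Fin n → GaugeConfig 4 L G → ℝ) (T : Finset (Fin n)) (hT : T.card < k)
    (hψm : ∀ a, Measurable (ψ a)) {Cψ : ℝ} (hψb : ∀ a U, |ψ a U| ≤ Cψ)
    (hψT : ∀ a ∈ T, ∀ U : GaugeConfig 4 L G, ∃ (c : ℝ) (M : Matrix (Fin N) (Fin N) ℂ) (o : Bool),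
      ∀ g : G, ψ a (update U ℓ g) = c + (ρ (if o then g else g⁻¹) * M).trace.re)
    (hψT' : ∀ a ∉ T, ∀ (U : GaugeConfig 4 L G) (g : G), ψ a (update U ℓ g) = ψ a U)
    (R : GaugeConfig 4 L G → ℝ) (hRm : Measurable R) {CR : ℝ} (hRb : ∀ U, |R U| ≤ CR)
    (hR : ∀ (U : GaugeConfig 4 L G) (g : G), R (update U ℓ g) = R U) :
    ∫ U, (π (plaquetteHolonomy U x i j)).trace.re * (∏ a, ψ a U) * R U
      ∂(Measure.pi fun _ : Edge 4 L => haarProbability G) = 0 := by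
  classical
  -- bounds and measurability of the integrand
  obtain ⟨Cπ, hCπ⟩ : ∃ C : ℝ, ∀ h : G, |(π h).trace.re| ≤ C := by
    obtain ⟨C, hC⟩ := isCompact_univ.exists_bound_of_continuousOn
      (Complex.continuous_re.comp hπ.matrix_trace).continuousOn
    exact ⟨C, fun h => Real.norm_eq_abs _ ▸ hC h (Set.mem_univ h)⟩
  have hCπ0 : 0 ≤ Cπ := le_trans (abs_nonneg _) (hCπ 1)
  set Φ : GaugeConfig 4 L G → ℝ := fun U => (π (plaquetteHolonomy U x i j)).trace.re * (∏ a, ψ a U) * R U with hΦ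
  have hΦm : Measurable Φ :=
    ((((Complex.continuous_re.comp hπ.matrix_trace).measurable.comp (measurable_plaquetteHolonomy x i j)).mul
      (Finset.measurable_prod _ fun a _ => hψm a)).mul hRm)
  have hΦb : ∀ U, |Φ U| ≤ Cπ * (max Cψ 0) ^ n * max CR 0 := fun U => by
    simp only [hΦ]
    rw [abs_mul, abs_mul, Finset.abs_prod]
    have h1 : ∏ a, |ψ a U| ≤ (max Cψ 0) ^ n := by
      calc ∏ a, |ψ a U| ≤ ∏ _a : Fin n, max Cψ 0 :=
            Finset.prod_le_prod (fun a _ => abs_nonneg _) (fun a _ => (hψb a U).trans (le_max_left _ _))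
        _ = (max Cψ 0) ^ n := by simp
    exact mul_le_mul (mul_le_mul (hCπ _) h1 (Finset.prod_nonneg fun _ _ => abs_nonneg _) hCπ0)
      ((hRb U).trans (le_max_left _ _)) (abs_nonneg _) (mul_nonneg hCπ0 (pow_nonneg (le_max_right _ _) _))
  rw [integral_pi_eq_integral_integral_update ℓ hΦm hΦb]
  -- the inner one-bond integral vanishes for every configuration
  have hinner : ∀ U : GaugeConfig 4 L G, ∫ g, Φ (update U ℓ g) ∂haarProbability G = 0 := by
    intro U
    obtain ⟨K, o₀, hK⟩ := exists_trace_holonomy_update π x hij U hℓ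
    have hsplit : ∀ g : G, ∏ a, ψ a (update U ℓ g) = (∏ a ∈ T, ψ a (update U ℓ g)) * ∏ a ∈ Tᶜ, ψ a U := by
      intro g
      rw [← Finset.prod_mul_prod_compl T]
      congr 1
      exact Finset.prod_congr rfl fun a ha => hψT' a (Finset.mem_compl.1 ha) U g
    have hrw : ∀ g : G, Φ (update U ℓ g) =
        (R U * ∏ a ∈ Tᶜ, ψ a U) *
          ((π (if o₀ then g else g⁻¹) * K).trace.re * ∏ a : ↥T, ψ a (update U ℓ g)) := by
      intro g
      simp only [hΦ]
      rw [hK g, hsplit g, hR U g, ← Finset.prod_coe_sort T]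
      ring
    simp_rw [hrw]
    rw [integral_const_mul, integral_linkObs_mul_prod_eq_zero π ρ hπ hρ hρu hV (ι := ↥T)
      (by rwa [Fintype.card_coe]) ⟨1, K, o₀, fun g => by rw [one_mul]⟩ (fun a => hψT a a.2 U), mul_zero]
  simp only [hinner, integral_zero]

end Peel

end Summit.QuantumFields.YangMills.Cruxes.IR.TensionRatio.PlaquetteFloor

end
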